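import Summits.Ventures.HodgeRepro2.T5SU11MeasurePreserving

/-!
# The Borel subgroup acts on the Iwasawa coordinates as the affine group: `n_σ a_τ · (s, t) = (σ + e^{2τ} s, τ + t)`; the invariance of `e^{-2t} ds dt`

In the `N A` chart `ζ = s + i t ↦ n_s a_t` of `B` (`T5SU11BorelHaarNA`), left multiplication by
`n_σ` is the translation `s ↦ s + σ` (`unip_mul_borelCoordNA`), by `a_τ` the dilation
`(s, t) ↦ (e^{2τ} s, t + τ)` (`hyp_mul_borelCoordNA`), and by `n_σ a_τ` the affine map
`affine σ τ : (s, t) ↦ (σ + e^{2τ} s, τ + t)` (`unip_mul_hyp_mul_borelCoordNA`) — the «`ax + b`» action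
of `B` on its own parameters, and, through `ζ ↦ (n_s a_t)·0`, on the disc: `n_σ · (n_s a_t)·0 = (n_{s+σ} a_t)·0`
and `a_τ · (n_s a_t)·0 = (n_{e^{2τ}s} a_{t+τ})·0` (`mobius_unip_iwasawaOrbit`, `mobius_hyp_iwasawaOrbit`).
The density `e^{-2t} ds dt` is invariant under every `affine σ τ` (`map_affine_iwasawaDensity`: the
left-invariance of `borelHaar` read back through the chart — the Jacobian `e^{2τ}` of the dilation is
compensated by the shift `t ↦ t + τ` of the density), the horocyclic-coordinate form of the
`B`-invariance of the Poincaré measure. Nothing is claimed about (N).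

Blind lane: Mathlib + the HodgeRepro2 prefix only; no sorry; axioms ⊆ {propext, Classical.choice,
Quot.sound}.
-/

namespace Summit.Ventures.HodgeRepro2.T5SU11AffineAction

open MeasureTheory MeasureTheory.Measure Metric Set Filter Topology Complex
open T5PoincareDensity T5PoincareInvariance T5PoincareMeasure T5SU11Unimodular T5SU11Fibration
  T5SU11FibrationHaar T5SU11Cartan T5SU11OneParameter T5BergmanCoefficient T5SU11UnipotentSubgroup
  T5SU11HyperbolicSubgroup T5SU11BorelSubgroup T5SU11IwasawaHaar T5SU11IwasawaMeasure
  T5SU11BorelHaar T5SU11BorelHaarNA T5SU11MeasurePreserving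
open scoped ENNReal NNReal Real

/-! ### Left multiplication by `N` and `A` in the `N A` chart -/

/-- `n_σ · (n_s a_t) = n_{s+σ} a_t`. -/
theorem unip_mul_borelCoordNA (σ : ℝ) (ζ : ℂ) :
    unip σ * borelCoordNA ζ = borelCoordNA (ζ + σ) := by
  unfold borelCoordNA
  rw [← mul_assoc, ← unip_add]
  simp only [Complex.add_re, Complex.ofReal_re, Complex.add_im, Complex.ofReal_im, add_zero]
  rw [add_comm σ]

/-- `a_τ · (n_s a_t) = n_{e^{2τ} s} a_{t+τ}`. -/
theorem hyp_mul_borelCoordNA (τ : ℝ) (ζ : ℂ) :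
    hyp τ * borelCoordNA ζ = borelCoordNA ⟨Real.exp (2 * τ) * ζ.re, ζ.im + τ⟩ := by
  unfold borelCoordNA
  rw [← mul_assoc, hyp_mul_unip, mul_assoc, ← hyp_add, add_comm τ]

/-- The affine map `(s, t) ↦ (σ + e^{2τ} s, τ + t)` of `ℂ = ℝ²`: left multiplication by `n_σ a_τ` in the
`N A` chart. -/
noncomputable def affine (σ τ : ℝ) (ζ : ℂ) : ℂ := ⟨σ + Real.exp (2 * τ) * ζ.re, τ + ζ.im⟩

/-- **`n_σ a_τ · (n_s a_t) = n_{σ + e^{2τ} s} a_{τ + t}`**: `B` acts on its `N A` parameters as the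
affine group. -/
theorem unip_mul_hyp_mul_borelCoordNA (σ τ : ℝ) (ζ : ℂ) :
    unip σ * hyp τ * borelCoordNA ζ = borelCoordNA (affine σ τ ζ) := by
  rw [mul_assoc, hyp_mul_borelCoordNA, unip_mul_borelCoordNA]
  unfold affine
  congr 1
  apply Complex.ext
  · simp only [Complex.add_re, Complex.ofReal_re]
    ring
  · simp only [Complex.add_im, Complex.ofReal_im, add_zero]
    ring

/-- `affine σ τ ζ = (σ + e^{2τ} Re ζ) + (τ + Im ζ) i`. -/
lemma affine_eq (σ τ : ℝ) (ζ : ℂ) :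
    affine σ τ ζ = ((σ + Real.exp (2 * τ) * ζ.re : ℝ) : ℂ) + ((τ + ζ.im : ℝ) : ℂ) * I := by
  apply Complex.ext
  · simp only [affine, Complex.add_re, Complex.ofReal_re, Complex.mul_re, Complex.ofReal_im,
      Complex.I_re, Complex.I_im]
    ring
  · simp only [affine, Complex.add_im, Complex.ofReal_im, Complex.mul_im, Complex.ofReal_re,
      Complex.I_re, Complex.I_im]
    ring

/-- `affine` is continuous. -/
lemma continuous_affine (σ τ : ℝ) : Continuous (affine σ τ) := by
  rw [show affine σ τ = fun ζ => ((σ + Real.exp (2 * τ) * ζ.re : ℝ) : ℂ) + ((τ + ζ.im : ℝ) : ℂ) * I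
    from funext (affine_eq σ τ)]
  fun_prop

/-- `affine` is measurable. -/
lemma measurable_affine (σ τ : ℝ) : Measurable (affine σ τ) := (continuous_affine σ τ).measurable

/-! ### The action on the disc in Iwasawa coordinates -/

/-- `n_σ · ((n_s a_t)·0) = (n_{s+σ} a_t)·0`. -/
theorem mobius_unip_iwasawaOrbit (σ : ℝ) (ζ : ℂ) :
    mobius (mat (unip σ)) (iwasawaOrbit ζ) = iwasawaOrbit (ζ + σ) := by
  show mobius (mat (unip σ)) (orbit (borelCoordNA ζ)) = orbit (borelCoordNA (ζ + σ))
  rw [← orbit_mul, unip_mul_borelCoordNA]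

/-- `a_τ · ((n_s a_t)·0) = (n_{e^{2τ} s} a_{t+τ})·0`. -/
theorem mobius_hyp_iwasawaOrbit (τ : ℝ) (ζ : ℂ) :
    mobius (mat (hyp τ)) (iwasawaOrbit ζ) = iwasawaOrbit ⟨Real.exp (2 * τ) * ζ.re, ζ.im + τ⟩ := by
  show mobius (mat (hyp τ)) (orbit (borelCoordNA ζ)) = orbit (borelCoordNA _)
  rw [← orbit_mul, hyp_mul_borelCoordNA]

/-- **`B` acts on the disc affinely in Iwasawa coordinates**:
`(n_σ a_τ) · ((n_s a_t)·0) = (n_{σ + e^{2τ} s} a_{τ + t})·0`. -/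
theorem mobius_unip_mul_hyp_iwasawaOrbit (σ τ : ℝ) (ζ : ℂ) :
    mobius (mat (unip σ * hyp τ)) (iwasawaOrbit ζ) = iwasawaOrbit (affine σ τ ζ) := by
  show mobius (mat (unip σ * hyp τ)) (orbit (borelCoordNA ζ)) = orbit (borelCoordNA _)
  rw [← orbit_mul, unip_mul_hyp_mul_borelCoordNA]

/-! ### The invariance of `e^{-2t} ds dt` under the affine action -/

/-- `borelCoordNAB ∘ affine σ τ = (n_σ a_τ ·) ∘ borelCoordNAB` in `B`. -/
lemma borelCoordNAB_affine (σ τ : ℝ) (hb : unip σ * hyp τ ∈ borelSubgroup) (ζ : ℂ) :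
    borelCoordNAB (affine σ τ ζ) = (⟨unip σ * hyp τ, hb⟩ : borelSubgroup) * borelCoordNAB ζ :=
  Subtype.ext (unip_mul_hyp_mul_borelCoordNA σ τ ζ).symm

/-- **`e^{-2t} ds dt` is invariant under the affine action of `B`**:
`(affine σ τ)_* iwasawaDensity = iwasawaDensity` — the left-invariance of `borelHaar` read in the
`N A` chart (the Jacobian `e^{2τ}` of the dilation is compensated by the shift of the density). -/
theorem map_affine_iwasawaDensity (σ τ : ℝ) :
    Measure.map (affine σ τ) iwasawaDensity = iwasawaDensity := by
  have hb : unip σ * hyp τ ∈ borelSubgroup := by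
    rw [unip_mul_hyp]
    exact hyp_mul_unip_mem_borelSubgroup _ _
  set b : borelSubgroup := ⟨unip σ * hyp τ, hb⟩ with hbdef
  -- push both sides into `B` along the embedding `borelCoordNAB`
  have h1 : Measure.map borelCoordNAB (Measure.map (affine σ τ) iwasawaDensity) =
      Measure.map borelCoordNAB iwasawaDensity := by
    rw [Measure.map_map measurable_borelCoordNAB (measurable_affine σ τ),
      show borelCoordNAB ∘ affine σ τ = (b * ·) ∘ borelCoordNAB from
        funext fun ζ => borelCoordNAB_affine σ τ hb ζ,
      ← Measure.map_map (measurable_const_mul b) measurable_borelCoordNAB, ← borelHaar_eq_map_NA,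
      map_mul_left_eq_self]
  -- a measurable embedding is injective on measures
  ext E hE
  have h2 := congrArg (fun μ : Measure borelSubgroup => μ (borelCoordNAB '' E)) h1
  rw [measurableEmbedding_borelCoordNAB.map_apply, measurableEmbedding_borelCoordNAB.map_apply,
    Set.preimage_image_eq _ measurableEmbedding_borelCoordNAB.injective] at h2
  exact h2

/-- `affine σ τ` is measure preserving for `e^{-2t} ds dt`. -/
theorem measurePreserving_affine (σ τ : ℝ) :
    MeasurePreserving (affine σ τ) iwasawaDensity iwasawaDensity :=
  ⟨measurable_affine σ τ, map_affine_iwasawaDensity σ τ⟩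

/-- **`∫ F(σ + e^{2τ} s, τ + t) e^{-2t} ds dt = ∫ F(s, t) e^{-2t} ds dt`** for every integrable `F`. -/
theorem integral_affine_iwasawaDensity (σ τ : ℝ) {E : Type*} [NormedAddCommGroup E]
    [NormedSpace ℝ E] (F : ℂ → E) (hF : AEStronglyMeasurable F iwasawaDensity) :
    ∫ ζ, F (affine σ τ ζ) ∂iwasawaDensity = ∫ ζ, F ζ ∂iwasawaDensity := by
  have hF' : AEStronglyMeasurable F (Measure.map (affine σ τ) iwasawaDensity) := by
    rw [map_affine_iwasawaDensity]
    exact hF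
  rw [← integral_map (measurable_affine σ τ).aemeasurable hF', map_affine_iwasawaDensity]

end Summit.Ventures.HodgeRepro2.T5SU11AffineAction
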